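import Summits.CriticalPhenomena.CardyFormulaZ2.Theorems.ParafermionPrecompact.Negative.HeadPassage
import Literature.Probability.LatticeModels.UnitDiscDiscretisation
import Literature.Probability.RandomPlanarGeometry.ChordalReversibility
import Literature.Probability.RandomPlanarGeometry.SLEExistenceNeEightHolds
import Literature.Probability.Process.KolmogorovExtensionProofs

/-!
# `ParafermionFamiliesToSLESix` (stmt-CriticalPhenomena-10814): the orientation tax — the conclusion
# asks the RAW exploration to converge to the time-reversal of SLE₆

Refuter `refuter-cdisprove-stmt-CriticalPhenomena-10814-g2-0` (cdisprove, cycle 2). Negative-side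
support for the provers of the crux and of every item concluding
`ConvergesInLawToSLE 6 D (re-oriented medial exploration) …` (the twin stmt-11389, the antecedent of
`SLESixFamiliesGiveCardy` stmt-9654, the Literature leaf `SLE6LimitZ2AllDiscretisations`). No `def`
is introduced. Self-contained companion of `RawExplorationRunsBToA.lean` (which refutes the
conclusion for the RAW curve); the few unit-disc facts both files need are re-derived here in the
sub-namespace `OrientationTax` so that neither file depends on the other.

* `reorient_eq_ite`, `reorient_eq_ite_startEdge` — the `else` branch of the conclusion's interface
  functional is `CurveClass.reverse`, and for admissible data the branch tests the START EDGE `e_a`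
  of the datum: the same branch for every configuration.
* `startCorner_discData` — on the tree's admissible discretisation `UnitDiscDiscretisation.discData`
  of `(𝔻; 1, -1)` the start corner is `((-M, 0), 3)`, so the exploration starts at `eL`
  (`b_δ → b = -1`): the H21 exploration keeps the wired arc `A ≈ (ab)` on its left and is sourced at
  the counter-clockwise `A → B` transition, which is at `b`. Hence `reorient_discData_eq_reverse`: for
  `δ < 1/3` the re-oriented interface IS the reversed exploration, for every configuration.
* `convergesInLawToSLE_congr`, `aemeasurable_reverse_comp_iff`, `tendstoLaw_reverse_iff`,
  `convergesInLawToSLE_ite_iff_of_eventually(_not)` — general transfer lemmas; hence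
  `conclusion_discData_iff_raw`: the conclusion on the disc family says exactly that the RAW
  exploration (from `b_δ`) converges in law to the TIME-REVERSAL of an SLE₆ in `(𝔻; 1, -1)`.
* `conclusion_discData_iff_natural_of_reversible` — a domain-Markov / observable-martingale argument
  along the exploration's own filtration yields "raw exploration → SLE₆ in the swapped domain
  `(𝔻; -1, 1)`"; GIVEN reversibility of chordal SLE₆ (J. Miller, S. Sheffield, *Imaginary geometry
  III*, Ann. of Math. 184 (2016) 455–486, `κ ∈ (4, 8)`; not in the tree) the two statements are
  equivalent (tree: `DobrushinDomain.swap`, `CurveClass.reverse`, `exists_isSLECurve_six`); without it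
  the tree has no bridge (the alternative, a discrete primal/dual self-duality dictionary for the
  `bcBondConfig` rendering, is not self-dual at the sites of the arc `B` and its dual data live on the
  half-mesh-shifted carrier `Ω - δ(1+i)/2`, outside the family class `(Λ δ).Ω = D.carrier` of every
  hypothesis and of the conclusion). Neither input is in the route or in any round-1 card.
-/

noncomputable section

namespace Summit.CriticalPhenomena.CardyFormulaZ2.Theorems.ParafermionFamiliesToSLESix.Negative.OrientationTax

open scoped Topology NNReal unitInterval ENNReal
open Filter MeasureTheory Set
open Literature.Probability.LatticeModels Literature.Probability.Percolation
open Literature.Probability.RandomPlanarGeometry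
open UnitDiscDiscretisation
open Literature.Probability.LatticeModels.DiscreteDobrushin (startCorner isStartCorner_startCorner
  existsUnique_startCorner IsStartCorner)

/-! ## Unit-disc facts (shared with `RawExplorationRunsBToA.lean`, re-derived) -/

section Disc

variable {δ : ℝ}

/-! The start corner of the tilted unit-disc data is `((-M, 0), 3)`: vertex `(-M, 0)` on the arc
`A`, direction `3` (south, towards `(-M, -1)` on the arc `B`); its source edge is the LEFT `A`–`B`
edge `eL`, at the discrete marked point `b_δ ≈ -1` (no `def` is introduced for it). -/

/-- The other endpoint of the source edge of `((-M,0),3)` is `(-M,-1)`. [folklore] -/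
theorem startVertex_add_cornerUnit (δ : ℝ) :
    (![-(abCol δ : ℤ), 0] : Site 2) + cornerUnit 3 = ![-(abCol δ : ℤ), -1] := by
  ext i; fin_cases i <;> simp [cornerUnit]

/-- The face of the corner `((-M,0),3)` is `(-M,-1)`. [folklore] -/
theorem faceAt_startVertex (δ : ℝ) : faceAt (![-(abCol δ : ℤ), 0] : Site 2) 3 = ![-(abCol δ : ℤ), -1] := by
  ext i; fin_cases i <;> simp [faceAt, cornerOff]

/-- The other face of the source edge of `((-M,0),3)` is `(-M-1,-1)`. [folklore] -/
theorem faceAt_startVertex_add_three (δ : ℝ) :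
    faceAt (![-(abCol δ : ℤ), 0] : Site 2) ((3 : Fin 4) + 3) = ![-(abCol δ : ℤ) - 1, -1] := by
  have h : (3 : Fin 4) + 3 = 2 := by decide
  rw [h]
  ext i; fin_cases i <;> simp [faceAt, cornerOff]

/-- The source edge of `((-M,0),3)` is `eL`. [folklore] -/
theorem cSrc_startVertex (δ : ℝ) : cSrc (((![-(abCol δ : ℤ), 0] : Site 2), (3 : Fin 4)) : Site 2 × Fin 4) = eL δ := by
  rw [cSrc, eL]
  show s((![-(abCol δ : ℤ), 0] : Site 2), (![-(abCol δ : ℤ), 0] : Site 2) + cornerUnit 3) = _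
  rw [startVertex_add_cornerUnit]

variable (hδ : 0 < δ) (hδ' : δ < 1 / 2)
include hδ hδ'

/-- `((-M,0),3)` is a start corner of the tilted data (`0 < δ < 1/2`). [folklore] -/
theorem isStartCorner_discData : (discData δ).IsStartCorner (((![-(abCol δ : ℤ), 0] : Site 2), (3 : Fin 4)) : Site 2 × Fin 4) where
  mem_zdArcA := xL0_mem_zdArcA hδ hδ'
  mem_zdArcB := by
    show (![-(abCol δ : ℤ), 0] : Site 2) + cornerUnit 3 ∈ (discData δ).zdArcB
    rw [startVertex_add_cornerUnit]; exact xL1_mem_zdArcB hδ hδ'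
  isOutEdge := by
    constructor
    · show (discData δ).IsInnerFace (faceAt (![-(abCol δ : ℤ), 0] : Site 2) 3)
      rw [faceAt_startVertex]; exact isInnerFace_fL hδ hδ'
    · show ¬ (discData δ).IsInnerFace (faceAt (![-(abCol δ : ℤ), 0] : Site 2) ((3 : Fin 4) + 3))
      rw [faceAt_startVertex_add_three]; exact not_isInnerFace_gL hδ hδ'

/-- **The start corner of the tilted unit-disc data is `((-M,0),3)`** (uniqueness of the start
corner): the exploration is sourced at the LEFT `A`–`B` edge, near `b = -1`. [folklore] -/
theorem startCorner_discData :
    startCorner (isZdAdmissible_discData hδ hδ') = (((![-(abCol δ : ℤ), 0] : Site 2), (3 : Fin 4)) : Site 2 × Fin 4) := by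
  have h1 := isStartCorner_startCorner (isZdAdmissible_discData hδ hδ')
  have h2 := isStartCorner_discData hδ hδ'
  exact (existsUnique_startCorner (isZdAdmissible_discData hδ hδ')).unique
    ⟨h1.mem_zdArcA, h1.mem_zdArcB, h1.isOutEdge⟩ ⟨h2.mem_zdArcA, h2.mem_zdArcB, h2.isOutEdge⟩

omit hδ hδ' in
/-- The first marked point of the unit disc Dobrushin domain is `a = 1`. [folklore] -/
theorem unitDisc_pt_zero : DobrushinDomain.unitDisc.pt 0 = 1 := by
  simp [MarkedDomain.pt, DobrushinDomain.unitDisc, JordanDomain.unitDisc, circleMap]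

omit hδ hδ' in
/-- The second marked point of the unit disc Dobrushin domain is `b = -1`. [folklore] -/
theorem unitDisc_pt_one : DobrushinDomain.unitDisc.pt 1 = -1 := by
  have h : DobrushinDomain.unitDisc.pt 1 = circleMap 0 1 (2 * Real.pi * (1 / 2)) := rfl
  rw [h, circleMap]
  have : ((2 * Real.pi * (1 / 2) : ℝ) : ℂ) * Complex.I = Real.pi * Complex.I := by push_cast; ring
  rw [this, Complex.exp_pi_mul_I]; simp

end Disc

/-! ## The orientation tax -/

section OrientationTax

open UnitDiscDiscretisation

/-- **The re-orientation is a deterministic time reversal**: the `else` branch of the conclusion's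
interface functional is `CurveClass.reverse` of the raw exploration class (definitionally,
`Curve.reverse γ = γ ∘ σ`). [folklore] -/
theorem reorient_eq_ite (D : DobrushinDomain) (E : DiscreteDobrushin) (ω : BondConfig (Site 2)) :
    CurveClass.mk
        (if dist (medialExplorationCurve E ω 0) (D.pt 0) ≤ dist (medialExplorationCurve E ω 0) (D.pt 1)
          then (⟨medialExplorationCurve E ω⟩ : Curve ℂ)
          else ⟨(medialExplorationCurve E ω).comp ⟨unitInterval.symm, unitInterval.continuous_symm⟩⟩) =
      if dist (medialExplorationCurve E ω 0) (D.pt 0) ≤ dist (medialExplorationCurve E ω 0) (D.pt 1)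
        then CurveClass.mk (⟨medialExplorationCurve E ω⟩ : Curve ℂ)
        else (CurveClass.mk (⟨medialExplorationCurve E ω⟩ : Curve ℂ)).reverse := by
  split_ifs <;> rfl

/-- For admissible data the raw exploration curve STARTS at the medial point of the start edge
`e_a = cSrc (startCorner hE)` — the same point for every configuration (sibling
`head_medialExploration`). [folklore] -/
theorem medialExplorationCurve_zero {E : DiscreteDobrushin} (hE : E.IsZdAdmissible)
    (ω : BondConfig (Site 2)) :
    medialExplorationCurve E ω 0 = medialPoint E.δ (cSrc (DiscreteDobrushin.startCorner hE)) := by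
  have hhead := Summit.CriticalPhenomena.CardyFormulaZ2.Theorems.ParafermionPrecompact.Negative.head_medialExploration hE ω
  obtain ⟨a, l, hal⟩ : ∃ a l, medialExploration E ω = a :: l := by
    cases h : medialExploration E ω with
    | nil => rw [h] at hhead; simp at hhead
    | cons a l => exact ⟨a, l, rfl⟩
  rw [hal, List.head?_cons, Option.some.injEq] at hhead
  rw [medialExplorationCurve, hal, List.map_cons, polyline_apply_zero, hhead]

/-- **The re-orientation branch is deterministic**: for admissible data the `if` of the
conclusion's interface functional tests the position of the START EDGE `e_a` (a datum of `E`)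
relative to the marked points — the same branch for every configuration `ω`; the re-oriented
interface is either the raw exploration class for all `ω`, or its time-reversal for all `ω`.
[folklore] -/
theorem reorient_eq_ite_startEdge {D : DobrushinDomain} {E : DiscreteDobrushin} (hE : E.IsZdAdmissible)
    (ω : BondConfig (Site 2)) :
    CurveClass.mk
        (if dist (medialExplorationCurve E ω 0) (D.pt 0) ≤ dist (medialExplorationCurve E ω 0) (D.pt 1)
          then (⟨medialExplorationCurve E ω⟩ : Curve ℂ)
          else ⟨(medialExplorationCurve E ω).comp ⟨unitInterval.symm, unitInterval.continuous_symm⟩⟩) =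
      if dist (medialPoint E.δ (cSrc (DiscreteDobrushin.startCorner hE))) (D.pt 0) ≤
          dist (medialPoint E.δ (cSrc (DiscreteDobrushin.startCorner hE))) (D.pt 1)
        then CurveClass.mk (⟨medialExplorationCurve E ω⟩ : Curve ℂ)
        else (CurveClass.mk (⟨medialExplorationCurve E ω⟩ : Curve ℂ)).reverse := by
  rw [reorient_eq_ite, medialExplorationCurve_zero hE ω]

variable {δ : ℝ}

/-- The raw exploration curve of the tilted unit-disc data starts at the discrete marked point
`b_δ = medialPoint δ eL` (for every configuration). [folklore] -/
theorem medialExplorationCurve_discData_zero (hδ : 0 < δ) (hδ' : δ < 1 / 2) (ω : BondConfig (Site 2)) :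
    medialExplorationCurve (discData δ) ω 0 = medialPoint δ (eL δ) := by
  rw [medialExplorationCurve_zero (isZdAdmissible_discData hδ hδ') ω, startCorner_discData hδ hδ',
    cSrc_startVertex]
  rfl

/-- **On the unit-disc family the conclusion's interface IS the reversed exploration**, for every
mesh `δ ∈ (0, 1/3)` and every configuration: the raw start `b_δ` is within `3δ` of `b = -1`, hence
farther from `a = 1`. [folklore] -/
theorem reorient_discData_eq_reverse (hδ : 0 < δ) (hδ3 : δ < 1 / 3) (ω : BondConfig (Site 2)) :
    CurveClass.mk
        (if dist (medialExplorationCurve (discData δ) ω 0) (DobrushinDomain.unitDisc.pt 0) ≤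
            dist (medialExplorationCurve (discData δ) ω 0) (DobrushinDomain.unitDisc.pt 1)
          then (⟨medialExplorationCurve (discData δ) ω⟩ : Curve ℂ)
          else ⟨(medialExplorationCurve (discData δ) ω).comp
            ⟨unitInterval.symm, unitInterval.continuous_symm⟩⟩) =
      (CurveClass.mk (⟨medialExplorationCurve (discData δ) ω⟩ : Curve ℂ)).reverse := by
  have hδ' : δ < 1 / 2 := by linarith
  rw [reorient_eq_ite, if_neg]
  rw [not_le, unitDisc_pt_zero, unitDisc_pt_one, medialExplorationCurve_discData_zero hδ hδ' ω]
  have hL := dist_medialPoint_eL_le hδ hδ'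
  have htri : dist (1:ℂ) (-1) ≤ dist (1:ℂ) (medialPoint δ (eL δ)) + dist (medialPoint δ (eL δ)) (-1) :=
    dist_triangle _ _ _
  have h2 : dist (1:ℂ) (-1) = 2 := by
    rw [dist_eq_norm, sub_neg_eq_add, show (1:ℂ) + 1 = ((2:ℝ) : ℂ) by push_cast; norm_num,
      Complex.norm_real]; norm_num
  have hc : dist (1:ℂ) (medialPoint δ (eL δ)) = dist (medialPoint δ (eL δ)) 1 := dist_comm _ _
  linarith

/-- Reversal inside a.e.-measurability (time reversal is a measurable involution). [folklore] -/
theorem aemeasurable_reverse_comp_iff {α : Type*} [MeasurableSpace α] {μ : Measure α}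
    {X : α → CurveClass ℂ} :
    AEMeasurable (fun a => (X a).reverse) μ ↔ AEMeasurable X μ := by
  refine ⟨fun h => ?_, fun h => CurveClass.measurable_reverse.comp_aemeasurable h⟩
  have : X = fun a => ((X a).reverse).reverse := by funext a; rw [CurveClass.reverse_reverse]
  rw [this]
  exact CurveClass.measurable_reverse.comp_aemeasurable h

/-- Reversal inside convergence in law (time reversal is a self-inverse isometry, so bounded
continuous test functions pull back to bounded continuous test functions). [folklore] -/
theorem tendstoLaw_reverse_iff {Ωδ : ℝ → Type*} [∀ δ, MeasurableSpace (Ωδ δ)]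
    {X : ∀ δ, Ωδ δ → CurveClass ℂ} {P : ∀ δ, Measure (Ωδ δ)} {Ω' : Type*} [MeasurableSpace Ω']
    {Z : Ω' → CurveClass ℂ} {μ : Measure Ω'} :
    TendstoLaw (fun δ ω => (X δ ω).reverse) P Z μ ↔ TendstoLaw X P (fun ω => (Z ω).reverse) μ := by
  constructor
  · intro h f
    have := h (f.compContinuous ⟨CurveClass.reverse, CurveClass.continuous_reverse⟩)
    simpa [BoundedContinuousFunction.compContinuous_apply] using this
  · intro h f
    have := h (f.compContinuous ⟨CurveClass.reverse, CurveClass.continuous_reverse⟩)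
    simpa [BoundedContinuousFunction.compContinuous_apply] using this

/-- `ConvergesInLawToSLE` only sees the interfaces at small meshes. [folklore] -/
theorem convergesInLawToSLE_congr {Ωδ : ℝ → Type*} [∀ δ, MeasurableSpace (Ωδ δ)]
    {X X' : ∀ δ, Ωδ δ → CurveClass ℂ} {P : ∀ δ, Measure (Ωδ δ)} {κ : ℝ≥0} {D : DobrushinDomain}
    (h : ∀ᶠ δ in 𝓝[>] (0:ℝ), X δ = X' δ) :
    ConvergesInLawToSLE κ D X P ↔ ConvergesInLawToSLE κ D X' P := by
  have hmeas : (∀ᶠ δ in 𝓝[>] (0:ℝ), AEMeasurable (X δ) (P δ)) ↔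
      ∀ᶠ δ in 𝓝[>] (0:ℝ), AEMeasurable (X' δ) (P δ) :=
    Filter.eventually_congr (h.mono fun δ hδ => by rw [hδ])
  have hlaw : ∀ (Γ : (ℝ≥0 → ℝ) → CurveClass ℂ),
      TendstoLaw X P Γ Literature.Probability.Process.preWienerMeasure ↔
        TendstoLaw X' P Γ Literature.Probability.Process.preWienerMeasure := by
    intro Γ
    refine forall_congr' fun f => Filter.tendsto_congr' ?_
    exact h.mono fun δ hδ => by simp only [hδ]
  unfold ConvergesInLawToSLE
  simp only [hmeas, hlaw]

/-- **General form of the orientation bookkeeping, `else` branch.** For any raw interface family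
`Y`, any re-orientation test `c` that eventually FAILS for every configuration, convergence of the
re-oriented family `if c then ⟦Y⟧ else ⟦Y⟧.reverse` to SLE_κ in `D` is EXACTLY convergence of the
raw family to the time-reversal of an SLE_κ in `D`. (With `reorient_eq_ite`/`iface_eq_ite` this is
the shape of the crux's conclusion; the test is ω-independent for admissible data.) [folklore] -/
theorem convergesInLawToSLE_ite_iff_of_eventually_not {Ωδ : ℝ → Type*} [∀ δ, MeasurableSpace (Ωδ δ)]
    {Y : ∀ δ, Ωδ δ → Curve ℂ} {c : ∀ δ, Ωδ δ → Prop} [∀ δ ω, Decidable (c δ ω)]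
    {P : ∀ δ, Measure (Ωδ δ)} {κ : ℝ≥0} {D : DobrushinDomain}
    (h : ∀ᶠ δ in 𝓝[>] (0:ℝ), ∀ ω, ¬ c δ ω) :
    ConvergesInLawToSLE κ D
        (fun δ ω => if c δ ω then CurveClass.mk (Y δ ω) else (CurveClass.mk (Y δ ω)).reverse) P ↔
      ∃ Γ, IsSLECurve κ D Γ ∧
        (∀ᶠ δ in 𝓝[>] (0:ℝ), AEMeasurable (fun ω => CurveClass.mk (Y δ ω)) (P δ)) ∧
        TendstoLaw (fun δ ω => CurveClass.mk (Y δ ω)) P (fun ω => (Γ ω).reverse)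
          Literature.Probability.Process.preWienerMeasure := by
  have hev : ∀ᶠ δ in 𝓝[>] (0:ℝ),
      (fun ω => if c δ ω then CurveClass.mk (Y δ ω) else (CurveClass.mk (Y δ ω)).reverse) =
        fun ω => (CurveClass.mk (Y δ ω)).reverse :=
    h.mono fun δ hδ => funext fun ω => by rw [if_neg (hδ ω)]
  rw [convergesInLawToSLE_congr (P := P) hev]
  unfold ConvergesInLawToSLE
  refine exists_congr fun Γ => and_congr_right fun _ => and_congr ?_ ?_
  · exact Filter.eventually_congr (Eventually.of_forall fun δ => aemeasurable_reverse_comp_iff)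
  · exact tendstoLaw_reverse_iff

/-- **General form, `then` branch**: if the test eventually HOLDS for every configuration, the
re-oriented family converges to SLE_κ iff the raw family does. [folklore] -/
theorem convergesInLawToSLE_ite_iff_of_eventually {Ωδ : ℝ → Type*} [∀ δ, MeasurableSpace (Ωδ δ)]
    {Y : ∀ δ, Ωδ δ → Curve ℂ} {c : ∀ δ, Ωδ δ → Prop} [∀ δ ω, Decidable (c δ ω)]
    {P : ∀ δ, Measure (Ωδ δ)} {κ : ℝ≥0} {D : DobrushinDomain}
    (h : ∀ᶠ δ in 𝓝[>] (0:ℝ), ∀ ω, c δ ω) :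
    ConvergesInLawToSLE κ D
        (fun δ ω => if c δ ω then CurveClass.mk (Y δ ω) else (CurveClass.mk (Y δ ω)).reverse) P ↔
      ConvergesInLawToSLE κ D (fun δ ω => CurveClass.mk (Y δ ω)) P :=
  convergesInLawToSLE_congr (h.mono fun δ hδ => funext fun ω => by rw [if_pos (hδ ω)])

/-- **What the conclusion says on the unit-disc family**: the RAW exploration of `discData δ`
(started at `b_δ → b = -1`, ended at `a_δ → a = 1`) converges in law to the TIME-REVERSAL of a
chordal SLE₆ in `(𝔻; 1, -1)`. [folklore] -/
theorem conclusion_discData_iff_raw :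
    ConvergesInLawToSLE 6 DobrushinDomain.unitDisc (Ωδ := fun _ => BondConfig (Site 2))
        (fun δ ω => CurveClass.mk
          (if dist (medialExplorationCurve (discData δ) ω 0) (DobrushinDomain.unitDisc.pt 0) ≤
              dist (medialExplorationCurve (discData δ) ω 0) (DobrushinDomain.unitDisc.pt 1)
            then (⟨medialExplorationCurve (discData δ) ω⟩ : Curve ℂ)
            else ⟨(medialExplorationCurve (discData δ) ω).comp
              ⟨unitInterval.symm, unitInterval.continuous_symm⟩⟩))
        (fun _ => bondPercolation (zdGraph 2) half) ↔
      ∃ Γ, IsSLECurve 6 DobrushinDomain.unitDisc Γ ∧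
        (∀ᶠ δ in 𝓝[>] (0:ℝ), AEMeasurable
          (fun ω => CurveClass.mk (⟨medialExplorationCurve (discData δ) ω⟩ : Curve ℂ))
          (bondPercolation (zdGraph 2) half)) ∧
        TendstoLaw (Ωδ := fun _ => BondConfig (Site 2))
          (fun δ ω => CurveClass.mk (⟨medialExplorationCurve (discData δ) ω⟩ : Curve ℂ))
          (fun _ => bondPercolation (zdGraph 2) half) (fun ω => (Γ ω).reverse)
          Literature.Probability.Process.preWienerMeasure := by
  have hev : ∀ᶠ δ in 𝓝[>] (0:ℝ), (fun ω => CurveClass.mk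
          (if dist (medialExplorationCurve (discData δ) ω 0) (DobrushinDomain.unitDisc.pt 0) ≤
              dist (medialExplorationCurve (discData δ) ω 0) (DobrushinDomain.unitDisc.pt 1)
            then (⟨medialExplorationCurve (discData δ) ω⟩ : Curve ℂ)
            else ⟨(medialExplorationCurve (discData δ) ω).comp
              ⟨unitInterval.symm, unitInterval.continuous_symm⟩⟩)) =
      fun ω => (CurveClass.mk (⟨medialExplorationCurve (discData δ) ω⟩ : Curve ℂ)).reverse := by
    filter_upwards [Ioo_mem_nhdsGT (show (0:ℝ) < 1 / 3 by norm_num)] with δ hδ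
    funext ω
    exact reorient_discData_eq_reverse hδ.1 hδ.2 ω
  rw [convergesInLawToSLE_congr (P := fun _ => bondPercolation (zdGraph 2) half) hev]
  unfold ConvergesInLawToSLE
  refine exists_congr fun Γ => and_congr_right fun _ => and_congr ?_ ?_
  · exact Filter.eventually_congr (Eventually.of_forall fun δ => aemeasurable_reverse_comp_iff)
  · exact tendstoLaw_reverse_iff

/-- **The orientation tax.** GIVEN reversibility of chordal SLE₆ on the disc (the law of the
time-reversal of an SLE₆ in `(𝔻; 1, -1)` is the law of an SLE₆ in the swapped domain
`(𝔻; -1, 1)`; Miller–Sheffield, Ann. Math. 184 (2016) 455–486, for `κ ∈ (4, 8)` — NOT in the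
tree), the conclusion on the unit-disc family is equivalent to the NATURAL statement for an
exploration process: the raw exploration, from its start `b_δ` to its end `a_δ`, converges in law
to chordal SLE₆ in `(𝔻; -1, 1)` — which is what a domain-Markov / martingale-observable argument
run along the exploration's own filtration produces. Without that input the tree has no bridge
between the two. (Reference for the hypothesis: J. Miller, S. Sheffield, *Imaginary geometry III:
reversibility of SLE_κ for κ ∈ (4,8)*, Ann. of Math. 184 (2016) 455–486, main theorem.) [folklore] -/
theorem conclusion_discData_iff_natural_of_reversible
    (hrev : ∀ Γ Γ', IsSLECurve 6 DobrushinDomain.unitDisc Γ →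
      IsSLECurve 6 DobrushinDomain.unitDisc.swap Γ' →
        Literature.Probability.Process.preWienerMeasure.map (fun ω => (Γ ω).reverse) =
          Literature.Probability.Process.preWienerMeasure.map Γ') :
    ConvergesInLawToSLE 6 DobrushinDomain.unitDisc (Ωδ := fun _ => BondConfig (Site 2))
        (fun δ ω => CurveClass.mk
          (if dist (medialExplorationCurve (discData δ) ω 0) (DobrushinDomain.unitDisc.pt 0) ≤
              dist (medialExplorationCurve (discData δ) ω 0) (DobrushinDomain.unitDisc.pt 1)
            then (⟨medialExplorationCurve (discData δ) ω⟩ : Curve ℂ)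
            else ⟨(medialExplorationCurve (discData δ) ω).comp
              ⟨unitInterval.symm, unitInterval.continuous_symm⟩⟩))
        (fun _ => bondPercolation (zdGraph 2) half) ↔
      ∃ Γ', IsSLECurve 6 DobrushinDomain.unitDisc.swap Γ' ∧
        (∀ᶠ δ in 𝓝[>] (0:ℝ), AEMeasurable
          (fun ω => CurveClass.mk (⟨medialExplorationCurve (discData δ) ω⟩ : Curve ℂ))
          (bondPercolation (zdGraph 2) half)) ∧
        TendstoLaw (Ωδ := fun _ => BondConfig (Site 2))
          (fun δ ω => CurveClass.mk (⟨medialExplorationCurve (discData δ) ω⟩ : Curve ℂ))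
          (fun _ => bondPercolation (zdGraph 2) half) Γ'
          Literature.Probability.Process.preWienerMeasure := by
  rw [conclusion_discData_iff_raw]
  -- the integral of a test function against the reversed SLE₆ is that against the swapped SLE₆
  have key : ∀ {Γ Γ'}, IsSLECurve 6 DobrushinDomain.unitDisc Γ →
      IsSLECurve 6 DobrushinDomain.unitDisc.swap Γ' → ∀ f : BoundedContinuousFunction (CurveClass ℂ) ℝ,
        ∫ ω, f ((Γ ω).reverse) ∂Literature.Probability.Process.preWienerMeasure =
          ∫ ω, f (Γ' ω) ∂Literature.Probability.Process.preWienerMeasure := by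
    intro Γ Γ' hΓ hΓ' f
    have h1 : AEMeasurable (fun ω => (Γ ω).reverse) Literature.Probability.Process.preWienerMeasure :=
      CurveClass.measurable_reverse.comp_aemeasurable hΓ.1
    rw [← integral_map h1 f.continuous.aestronglyMeasurable,
      ← integral_map hΓ'.1 f.continuous.aestronglyMeasurable, hrev Γ Γ' hΓ hΓ']
  constructor
  · rintro ⟨Γ, hΓ, hmeas, hlaw⟩
    obtain ⟨Γ', hΓ'⟩ := exists_isSLECurve_six DobrushinDomain.unitDisc.swap
    refine ⟨Γ', hΓ', hmeas, fun f => ?_⟩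
    rw [← key hΓ hΓ' f]
    exact hlaw f
  · rintro ⟨Γ', hΓ', hmeas, hlaw⟩
    obtain ⟨Γ, hΓ⟩ := exists_isSLECurve_six DobrushinDomain.unitDisc
    refine ⟨Γ, hΓ, hmeas, fun f => ?_⟩
    rw [key hΓ hΓ' f]
    exact hlaw f

end OrientationTax

end Summit.CriticalPhenomena.CardyFormulaZ2.Theorems.ParafermionFamiliesToSLESix.Negative.OrientationTax
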